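import Mathlib
import HarnessLib

/-!
# The coordinate ring of `SL_n × ⋯ × SL_n` is an integral domain

Topic `RepresentationTheory/AlgebraicGroups`; theorems only. For a field `K`, a finite index type
`ι` (matrix size) and a finite type `κ` (number of factors), the ideal
`J = (det X⁽ᵖ⁾ - 1 : p ∈ κ)` of the polynomial ring `K[x_{p,i,j}]` in the entries of `κ` generic
`ι × ι` matrices `X⁽ᵖ⁾` is prime, i.e. `K[SL_ι^κ] = K[x] / J` is an integral domain
(`isDomain_mvPolynomial_quotient_span_det_sub_one`, `isPrime_span_det_sub_one`).

Proof (no dimension theory, no irreducibility of `det - 1` as a polynomial): `K[x]/J` embeds into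
the domain `K[x][1/D]`, `D = ∏_p det X⁽ᵖ⁾`, by the algebra map `ψ` rescaling one column of each
`X⁽ᵖ⁾` by `(det X⁽ᵖ⁾)⁻¹` (so `ψ(det X⁽ᵖ⁾) = 1` and `ψ` kills `J`); the map `φ : K[x][1/D] → K[x]/J`
(which exists because `D ≡ 1 (mod J)`) is a left inverse of the induced `ψ̄`, since both fix the
generators `x_{p,i,j}` modulo `J`. Geometrically: `GL_n ≅ SL_n × 𝔾_m` as varieties.

Consumer: the valuative proof of the Hilbert–Mumford criterion for `SL_m(ℂ)³` acting on
`3`-tensors (route MatrixMultiplication/ToricBorderRank, item `HilbertMumfordHalf`), which needs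
the generic point of `SL³` over the function field `Frac K[SL³]` and the Nullstellensatz for `J`.

## References

Folklore (e.g. T. A. Springer, *Linear Algebraic Groups*, 2nd ed., 2.1.4: `SL_n` is a connected,
hence irreducible, algebraic group; the retraction argument here is the standard proof that
`K[GL_n] = K[SL_n] ⊗ K[t, t⁻¹]`).
-/

open MvPolynomial Matrix

namespace Literature.RepresentationTheory.AlgebraicGroups

variable (K : Type*) [Field K] (κ ι : Type*) [Fintype κ] [Fintype ι] [DecidableEq ι]

omit [Fintype κ] in
/-- The determinant of a generic matrix is a nonzero polynomial (its value at the identity matrix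
is `1`). [folklore] -/
theorem det_genericMatrix_ne_zero (p : κ) :
    (Matrix.of fun i j => (X (p, i, j) : MvPolynomial (κ × ι × ι) K)).det ≠ 0 := by
  intro h
  have h1 := congr_arg (MvPolynomial.eval fun s : κ × ι × ι => if s.2.1 = s.2.2 then (1 : K) else 0) h
  rw [RingHom.map_det, map_zero] at h1
  have h2 : (MvPolynomial.eval fun s : κ × ι × ι => if s.2.1 = s.2.2 then (1 : K) else 0).mapMatrix
      (Matrix.of fun i j => (X (p, i, j) : MvPolynomial (κ × ι × ι) K)) = 1 := by
    ext i j
    simp [Matrix.one_apply]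
  rw [h2, det_one] at h1
  exact one_ne_zero h1

/-- **`K[SL_ι^κ]` is an integral domain**: the quotient of `K[x_{p,i,j} : p ∈ κ, i j ∈ ι]` by the
ideal generated by the `det X⁽ᵖ⁾ - 1` is a domain. [folklore] -/
theorem isDomain_mvPolynomial_quotient_span_det_sub_one :
    IsDomain (MvPolynomial (κ × ι × ι) K ⧸ Ideal.span (Set.range fun p : κ =>
      (Matrix.of fun i j => (X (p, i, j) : MvPolynomial (κ × ι × ι) K)).det - 1)) := by
  classical
  set R₀ := MvPolynomial (κ × ι × ι) K with hR₀
  set Xm : κ → Matrix ι ι R₀ := fun p => Matrix.of fun i j => (X (p, i, j) : R₀) with hXm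
  set J : Ideal R₀ := Ideal.span (Set.range fun p : κ => (Xm p).det - 1) with hJ
  show IsDomain (R₀ ⧸ J)
  rcases isEmpty_or_nonempty ι with hι | ⟨⟨j₀⟩⟩
  · -- no matrix entries: every determinant is `1` and `J = ⊥`
    have hJbot : J = ⊥ := by
      rw [hJ, Ideal.span_eq_bot]
      rintro _ ⟨p, rfl⟩
      simp [det_isEmpty]
    rw [hJbot]
    exact (Ideal.Quotient.isDomain_iff_prime _).mpr Ideal.isPrime_bot
  -- the localisation `K[x][1/D]`, a domain
  set D : R₀ := ∏ p, (Xm p).det with hD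
  have hD0 : D ≠ 0 := Finset.prod_ne_zero_iff.mpr fun p _ => det_genericMatrix_ne_zero K κ ι p
  set S := Localization.Away D with hS
  haveI : IsDomain S := IsLocalization.Away.isDomain (S := S) hD0
  have hunit : ∀ p, IsUnit (algebraMap R₀ S (Xm p).det) := fun p => by
    have hdvd : (Xm p).det ∣ D := Finset.dvd_prod_of_mem (fun q => (Xm q).det) (Finset.mem_univ p)
    exact isUnit_of_dvd_unit (map_dvd (algebraMap R₀ S) hdvd)
      (IsLocalization.Away.algebraMap_isUnit D)
  -- `ψ`: rescale column `j₀` of each generic matrix by the inverse determinant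
  set c : κ → S := fun p => ((hunit p).unit⁻¹ : Sˣ) with hc
  set g : κ × ι × ι → S := fun s => algebraMap R₀ S (X s) * (if s.2.2 = j₀ then c s.1 else 1) with hg
  set ψ : R₀ →ₐ[K] S := MvPolynomial.aeval g with hψ
  have hψX : ∀ s, ψ (X s) = g s := fun s => by rw [hψ, aeval_X]
  have hψmat : ∀ p, (Xm p).map ψ =
      updateCol ((Xm p).map (algebraMap R₀ S)) j₀ (c p • fun i => ((Xm p).map (algebraMap R₀ S)) i j₀) := by
    intro p
    ext i j
    simp only [Matrix.map_apply, hXm, Matrix.of_apply, hψX, hg, updateCol_apply, Pi.smul_apply,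
      smul_eq_mul]
    by_cases hj : j = j₀
    · subst hj; simp [mul_comm]
    · simp [hj]
  have hψdet : ∀ p, ψ (Xm p).det = 1 := by
    intro p
    rw [AlgHom.map_det, AlgHom.mapMatrix_apply, hψmat, det_updateCol_smul, updateCol_eq_self,
      ← RingHom.mapMatrix_apply, ← RingHom.map_det, hc]
    exact (hunit p).val_inv_mul
  have hJψ : ∀ a ∈ J, ψ a = 0 := by
    intro a ha
    rw [hJ] at ha
    refine Submodule.span_induction (p := fun a _ => ψ a = 0) ?_ (map_zero ψ) (fun x y _ _ hx hy => by
      rw [map_add, hx, hy, add_zero]) (fun r x _ hx => by rw [smul_eq_mul, map_mul, hx, mul_zero]) ha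
    rintro _ ⟨p, rfl⟩
    rw [map_sub, hψdet, map_one, sub_self]
  set ψbar : R₀ ⧸ J →ₐ[K] S := Ideal.Quotient.liftₐ J ψ hJψ with hψbar
  -- `φ`: `D ≡ 1 mod J` makes `K[x][1/D] → K[x]/J` available
  have hmkdet : ∀ p, Ideal.Quotient.mkₐ K J (Xm p).det = 1 := by
    intro p
    rw [Ideal.Quotient.mkₐ_eq_mk, ← map_one (Ideal.Quotient.mk J), Ideal.Quotient.eq]
    exact Ideal.subset_span ⟨p, rfl⟩
  have hmkD : IsUnit (Ideal.Quotient.mkₐ K J D) := by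
    rw [hD, map_prod, Finset.prod_eq_one fun p _ => hmkdet p]
    exact isUnit_one
  set φ : S →ₐ[K] R₀ ⧸ J := IsLocalization.Away.liftAlgHom D hmkD with hφ
  have hφalg : ∀ a : R₀, φ (algebraMap R₀ S a) = Ideal.Quotient.mk J a := by
    intro a
    rw [hφ]
    change (IsLocalization.Away.liftAlgHom D hmkD : S →ₐ[K] R₀ ⧸ J).toRingHom (algebraMap R₀ S a) = _
    rw [IsLocalization.Away.liftAlgHom_toRingHom, IsLocalization.Away.lift_eq]
    rfl
  have hφc : ∀ p, φ (c p) = 1 := by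
    intro p
    have h1 : φ (c p) * φ (algebraMap R₀ S (Xm p).det) = 1 := by
      rw [← map_mul, hc, (hunit p).val_inv_mul, map_one]
    rw [hφalg] at h1
    have h2 : Ideal.Quotient.mk J (Xm p).det = 1 := hmkdet p
    rwa [h2, mul_one] at h1
  -- `φ ∘ ψ̄ = id`
  have hcomp : φ.comp ψbar = AlgHom.id K (R₀ ⧸ J) := by
    refine Ideal.Quotient.algHom_ext K (MvPolynomial.algHom_ext fun s => ?_)
    simp only [AlgHom.comp_apply, AlgHom.id_apply, Ideal.Quotient.mkₐ_eq_mk]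
    rw [hψbar, Ideal.Quotient.liftₐ_apply, Ideal.Quotient.lift_mk, AlgHom.coe_toRingHom, hψX, hg]
    simp only [map_mul, hφalg]
    by_cases hs : s.2.2 = j₀
    · rw [if_pos hs, hφc, mul_one]
    · rw [if_neg hs, map_one, mul_one]
  have hinj : Function.Injective ψbar := by
    intro a b hab
    have := congr_arg φ hab
    rwa [← AlgHom.comp_apply, ← AlgHom.comp_apply, hcomp, AlgHom.id_apply, AlgHom.id_apply] at this
  exact Function.Injective.isDomain ψbar.toRingHom hinj

/-- **The ideal `(det X⁽ᵖ⁾ - 1 : p)` of `SL_ι^κ` is prime.** [folklore] -/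
theorem isPrime_span_det_sub_one :
    (Ideal.span (Set.range fun p : κ =>
      (Matrix.of fun i j => (X (p, i, j) : MvPolynomial (κ × ι × ι) K)).det - 1)).IsPrime :=
  (Ideal.Quotient.isDomain_iff_prime _).mp (isDomain_mvPolynomial_quotient_span_det_sub_one K κ ι)

end Literature.RepresentationTheory.AlgebraicGroups
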